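import Literature.AnabelianGeometry.SemiGraphs.TemperedSpecialFibreTowerFreeProfiniteWitness
import Literature.IUT.HodgeTheaters.ProfiniteCompletionFreeAbelianTorsionFree
import HarnessLib

/-!
# [IUTchI] Prop. 2.4 (i): the law "`Δ̂_X` is strongly torsion-free" (`hTF`, printed form) is INDEPENDENT of the
# origin data `TemperedCurve` + `GroupLevelData` + `SpecialFibreData` + `SpecialFibreTower` + `PiData` — and holds,
# together with `hab` and `hadm`, at the free-profinite witness (non-vacuity of the §2 one-call's first law)

Mochizuki, *Inter-universal Teichmüller theory I*, kurims manuscript (May 2020), §2, proof of Prop. 2.4 (i),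
p. 50 l. 27: "since [as is well-known — cf., e.g., [Config], Remark 1.2.2] `Δ̂_X` is *strongly torsion-free*"
[cite: Mochizuki2012, Prop 2.4(i) p.50] (D-0012 claim key; nothing of the series is asserted here); the witness groups
are Mochizuki, *Semi-graphs of anabelioids*, Publ. RIMS **42** (2006), Ex. 3.10 p. 44 shapes
[cite: MochizukiSemiAnbd2006, Ex 3.10 p.44] (`Π^temp := G_{ℚ_p} × A`, abc-iut-L3-t2's witnesses).

PROOF-ONLY companion (abc-iut-f-193 gen 4, block F tranche 193 = FACT-LIST F-2599/F-2600/F-2601; no definition, no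
instance, no new `Prop` fact).  In the one-call forms of [IUTchI] Prop. 2.4 (i)(ii)(iii) ∧ Cor. 2.5 at the genuine
constructor `StableCurveTemperedData.ofSpecialFibre X d S …` (abc-iut-L5-t11's `prop24_cor25_ofPiData_of_printedLaws`
p447838 / `prop24_cor25_ofPiData_byName` p451534, abc-iut-f-193's `…_of_admKer_nhds_one` p445986) the first law is
`hTF : ∀ H ⊆ X.DeltaHat open, ∀ h n, n ≠ 0 → SigmaCharDetects Set.univ H h → SigmaCharDetects Set.univ H (h ^ n)`
([Config] Rmk 1.2.2 in the character language of abc-iut-w5-d119's `SigmaCharDetects`).  This file settles its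
STATUS relative to the origin records the one-call sits over:

* `SigmaCharDetects.of_continuous_map`, `torsionFreeAb_of_continuousMulEquiv` — the printed form is transported
  along isomorphisms of topological groups (bookkeeping);
* `TemperedCurve.nonempty_continuousMulEquiv_deltaHat_of_compactSpace_deltaTemp` — for ANY `X : TemperedCurve p`
  whose `Δ^temp_X` is compact, `Δ^temp_X ≃ₜ* Δ̂_X` (the image of a compact group in the Hausdorff `Π̂_X` is closed,
  so the closure `Δ̂_X` is the image; cf. abc-iut-L3's `deltaToHat_bijective_of_compactSpace`, which assumes `Π^temp`
  compact);
* `PadicAffine.not_torsionFreeAb` — **`hTF` FAILS for `Aff(ℤ_p)`, `p` odd**: in the open subgroup `Aff(ℤ_p)` itself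
  the involution `(0, −1)` is detected by the continuous character `(a, u) ↦ u mod p ∈ (ℤ/p)^×` while its square `1` is
  detected by none — so at the PiData witness OF RECORD (`SpecialFibreTower.PiData.exists_inhabited` /
  `…exists_temperedCurve_padicAffine`, `Δ̂ ≅ Aff(ℤ_p)`) the binder `hTF` is FALSE:
  `OfSpecialFibre.exists_piData_not_torsionFreeAb`;
* **`OfSpecialFibre.exists_piData_torsionFreeAb_ab_adm` — JOINT NON-VACUITY of `{PiData, FiniteLevels, hTF, hab,
  hadm}`**: at abc-iut-L3-t2's free-profinite witness (`PiData.exists_temperedCurve_freeProfiniteTwo`: `K := ℚ_p`,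
  `Π^temp := G_{ℚ_p} × F̂₂`, `Δ̂_X ≅ F̂₂`) the law `hTF` HOLDS (abc-iut-w4-d055's
  `ProfiniteCompletion.sigmaCharDetects_univ_pow_of_isFreeGroup` — open subgroups of `F̂₂` are free profinite with
  torsion-free abelianization — transported along `F̂₂ ≃ₜ* Δ^temp_X ≃ₜ* Δ̂_X`), and so do `hab` (the admissible kernels
  are `1`) and `hadm` (idem).

CONCLUSION (numbers, not adjectives): `hTF` is neither refutable nor derivable from the origin records (both `hTF` and
`¬ hTF` are realised over inhabited `PiData`), i.e. it is a GENUINE law binder of the one-call; and the one-call's law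
package restricted to `{hTF, hab, hadm}` has a joint witness.  HONEST LIMITS: the witnesses have profinite `Π^temp`, no
closed points, one-vertex fibres — consistency evidence for OUR binders only, not a curve; the remaining laws
(`hNN_i`, `hI_j`, `hRF_j`, `hA3ar_j` of p451534) are not touched here.  Nothing here bears on [IUTchIII] Cor. 3.12;
typed ≠ inhabited ≠ discharged.
-/

noncomputable section

namespace Literature.IUT.HodgeTheaters

open _root_.Topology
open Literature.AnabelianGeometry.SemiGraphs Literature.GroupTheory.SpecificGroups

universe u

/-! ### 1. Transport of the printed form "torsion-free abelianizations of open subgroups" -/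

/-- Detection by continuous finite abelian `Σ`-characters PULLS BACK along a continuous homomorphism between subgroup
types: if `f x` is detected in `K`, then `x` is detected in `H` (compose the character with `f`; the kernel is the
preimage of an open set). ([IUTchI] Prop 2.4(i) p.50) [claim: Mochizuki2012, status: disputed] -/
theorem SigmaCharDetects.of_continuous_map {P Q : Type u} [Group P] [TopologicalSpace P] [Group Q]
    [TopologicalSpace Q] {S : Set ℕ} {H : Subgroup P} {K : Subgroup Q} (f : H →* K) (hf : Continuous f) (x : H)
    (h : SigmaCharDetects S K (f x)) : SigmaCharDetects S H x := by
  obtain ⟨A, iA, iF, χ, hχker, hS, hχx⟩ := h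
  refine ⟨A, iA, iF, χ.comp f, ?_, hS, ?_⟩
  · have : (((χ.comp f).ker : Subgroup H) : Set H) = f ⁻¹' ((χ.ker : Subgroup K) : Set K) := by
      ext y
      simp only [SetLike.mem_coe, MonoidHom.mem_ker, MonoidHom.comp_apply, Set.mem_preimage]
    rw [this]
    exact hχker.preimage hf
  · simpa only [MonoidHom.comp_apply] using hχx

/-- **Transport of the printed form of [Config] Rmk 1.2.2 along an isomorphism of topological groups**: if every open
subgroup of `A` has torsion-free abelianization (character form, all finite abelian targets), so does every open
subgroup of `B ≅ A`. ([IUTchI] Prop 2.4(i) p.50) [claim: Mochizuki2012, status: disputed] -/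
theorem torsionFreeAb_of_continuousMulEquiv {A B : Type u} [Group A] [TopologicalSpace A] [Group B]
    [TopologicalSpace B] (e : A ≃ₜ* B)
    (hA : ∀ H : Subgroup A, IsOpen (H : Set A) → ∀ (h : H) (n : ℕ), n ≠ 0 →
      SigmaCharDetects Set.univ H h → SigmaCharDetects Set.univ H (h ^ n)) :
    ∀ H : Subgroup B, IsOpen (H : Set B) → ∀ (h : H) (n : ℕ), n ≠ 0 →
      SigmaCharDetects Set.univ H h → SigmaCharDetects Set.univ H (h ^ n) := by
  intro H hH h n hn hdet
  -- the open subgroup `H' := e⁻¹(H)` of `A`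
  let H' : Subgroup A := H.comap e.toMulEquiv.toMonoidHom
  have hmem : ∀ a, a ∈ H' ↔ e a ∈ H := fun a => Iff.rfl
  have hH' : IsOpen (H' : Set A) := hH.preimage e.continuous
  -- the two continuous homomorphisms `H' ⇄ H` induced by `e`
  let eH : H' →* H :=
    { toFun := fun x => ⟨e x.1, (hmem x.1).1 x.2⟩
      map_one' := Subtype.ext (map_one e)
      map_mul' := fun x y => Subtype.ext (map_mul e x.1 y.1) }
  let eH' : H →* H' :=
    { toFun := fun y => ⟨e.symm y.1, (hmem _).2 (by rw [e.apply_symm_apply]; exact y.2)⟩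
      map_one' := Subtype.ext (map_one e.symm)
      map_mul' := fun x y => Subtype.ext (map_mul e.symm x.1 y.1) }
  have hc : Continuous eH := (e.continuous.comp continuous_subtype_val).subtype_mk _
  have hc' : Continuous eH' := (e.symm.continuous.comp continuous_subtype_val).subtype_mk _
  have h1 : eH (eH' h) = h := Subtype.ext (e.apply_symm_apply h.1)
  -- `h = eH (eH' h)` is detected, hence `eH' h` is; apply `hA`; push forward again
  have hdet' : SigmaCharDetects Set.univ H' (eH' h) :=
    SigmaCharDetects.of_continuous_map eH hc _ (by rw [h1]; exact hdet)
  have hpow := hA H' hH' (eH' h) n hn hdet'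
  refine SigmaCharDetects.of_continuous_map eH' hc' _ ?_
  rw [map_pow]
  exact hpow

/-! ### 2. `Δ^temp_X ≃ₜ* Δ̂_X` whenever `Δ^temp_X` is compact -/

section DeltaHat

variable {p : ℕ} [Fact p.Prime]

/-- For a §6 datum whose `Δ^temp_X` is COMPACT, the restriction `Δ^temp_X → Δ̂_X` of `Π^temp_{X_K} ↪ Π̂_{X_K}` is
bijective: the image of the compact `Δ^temp_X` in the Hausdorff `Π̂_{X_K}` is closed, so its closure `Δ̂_X` is the image.
(Only `Δ^temp_X` — not `Π^temp_{X_K}` — is assumed compact.) [cite: MochizukiSemiAnbd2006, §6 p.69] -/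
theorem _root_.Literature.AnabelianGeometry.SemiGraphs.TemperedCurve.deltaToHat_bijective_of_compactSpace_deltaTemp
    (X : TemperedCurve p) [CompactSpace X.DeltaTemp] :
    Function.Bijective X.deltaToHat := by
  haveI := X.isProfiniteCompletion_toHat.t2Space
  refine ⟨fun a b h => Subtype.ext (X.toHat_injective (congrArg Subtype.val h)), fun y => ?_⟩
  have hclosed : IsClosed ((X.DeltaTemp.map X.toHat.toMonoidHom : Subgroup X.PiHat) : Set X.PiHat) := by
    rw [Subgroup.coe_map]
    exact ((isCompact_iff_compactSpace.mpr ‹CompactSpace X.DeltaTemp›).image X.toHat.continuous).isClosed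
  have hle : X.DeltaHat ≤ X.DeltaTemp.map X.toHat.toMonoidHom :=
    Subgroup.topologicalClosure_minimal _ le_rfl hclosed
  obtain ⟨g, hg, hgy⟩ := hle y.2
  exact ⟨⟨g, hg⟩, Subtype.ext hgy⟩

/-- For a §6 datum whose `Δ^temp_X` is COMPACT, `Δ^temp_X ≃ₜ* Δ̂_X` along the natural map (a continuous bijection
from a compact space to a Hausdorff space is a homeomorphism). [cite: MochizukiSemiAnbd2006, §6 p.69] -/
theorem _root_.Literature.AnabelianGeometry.SemiGraphs.TemperedCurve.nonempty_continuousMulEquiv_deltaHat_of_compactSpace_deltaTemp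
    (X : TemperedCurve p)
    [CompactSpace X.DeltaTemp] : Nonempty (X.DeltaTemp ≃ₜ* X.DeltaHat) := by
  haveI := X.isProfiniteCompletion_toHat.t2Space
  let f : X.DeltaTemp ≃ X.DeltaHat :=
    Equiv.ofBijective X.deltaToHat X.deltaToHat_bijective_of_compactSpace_deltaTemp
  let h : X.DeltaTemp ≃ₜ X.DeltaHat := Continuous.homeoOfEquivCompactToT2 (f := f) X.deltaToHat.continuous
  exact ⟨{ h with map_mul' := fun a b => map_mul X.deltaToHat a b }⟩

end DeltaHat

/-! ### 3. The printed form FAILS for `Aff(ℤ_p)`, `p` odd -/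

/-- **[Config] Rmk 1.2.2's printed form FAILS for the `p`-adic affine group `Aff(ℤ_p) = ℤ_p ⋊ ℤ_pˣ`, `p ≠ 2`**: the
abelianization of the (open) whole group has `2`-torsion — the involution `(0, −1)` is detected by the continuous
character `(a, u) ↦ u mod p` with values in `(ℤ/p)^×` (kernel ⊇ the congruence subgroup `Γ₁`), while its square `1` is
detected by no character.  Hence the strongly-torsion-free law cannot hold at any datum with `Δ̂ ≅ Aff(ℤ_p)`.
[cite: MochizukiSemiAnbd2006, §0 p.6] -/
theorem _root_.Literature.GroupTheory.SpecificGroups.PadicAffine.not_torsionFreeAb (p : ℕ) [Fact p.Prime]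
    (hp : p ≠ 2) :
    ¬ ∀ H : Subgroup (PadicAffine p), IsOpen (H : Set (PadicAffine p)) → ∀ (h : H) (n : ℕ), n ≠ 0 →
        SigmaCharDetects Set.univ H h → SigmaCharDetects Set.univ H (h ^ n) := by
  intro hTF
  haveI : NeZero p := ⟨(Fact.out : p.Prime).ne_zero⟩
  haveI : Fact (2 < p) := ⟨lt_of_le_of_ne (Fact.out : p.Prime).two_le (Ne.symm hp)⟩
  -- the involution `(0, -1)` of the open subgroup `⊤`
  let h0 : PadicAffine p := ⟨0, -1⟩
  have hsq : h0 * h0 = 1 := by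
    ext
    · simp [h0]
    · simp [h0]
  let h : (⊤ : Subgroup (PadicAffine p)) := ⟨h0, Subgroup.mem_top _⟩
  have hsq' : h ^ 2 = 1 := by
    apply Subtype.ext
    change h0 ^ 2 = 1
    rw [pow_two, hsq]
  -- the character `(a, u) ↦ u mod p`
  let υ : PadicAffine p →* ℤ_[p]ˣ :=
    { toFun := fun x => x.u, map_one' := rfl, map_mul' := fun _ _ => rfl }
  let ρ : PadicAffine p →* (ZMod p)ˣ := (Units.map (PadicInt.toZMod (p := p)).toMonoidHom).comp υ
  have hρker : IsOpen ((ρ.ker : Subgroup (PadicAffine p)) : Set (PadicAffine p)) := by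
    refine Subgroup.isOpen_mono ?_ (PadicAffine.isOpen_level (p := p) 1)
    intro x hx
    rw [PadicAffine.mem_level_iff] at hx
    have h2 : (x.u : ℤ_[p]) - 1 ∈ RingHom.ker (PadicInt.toZMod (p := p)) := by
      rw [PadicInt.ker_toZMod, PadicInt.maximalIdeal_eq_span_p]
      have h3 := hx.2
      simp only [PadicAffine.I, pow_one] at h3
      exact h3
    rw [RingHom.mem_ker, map_sub, map_one, sub_eq_zero] at h2
    rw [MonoidHom.mem_ker]
    exact Units.ext (by simpa [ρ, υ] using h2)
  let χ : (⊤ : Subgroup (PadicAffine p)) →* (ZMod p)ˣ := ρ.comp (Subgroup.subtype ⊤)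
  have hdet : SigmaCharDetects Set.univ (⊤ : Subgroup (PadicAffine p)) h := by
    refine ⟨(ZMod p)ˣ, inferInstance, inferInstance, χ, ?_, fun q _ _ => Set.mem_univ q, ?_⟩
    · have : ((χ.ker : Subgroup (⊤ : Subgroup (PadicAffine p))) : Set (⊤ : Subgroup (PadicAffine p))) =
          Subtype.val ⁻¹' ((ρ.ker : Subgroup (PadicAffine p)) : Set (PadicAffine p)) := by
        ext x
        simp only [SetLike.mem_coe, MonoidHom.mem_ker, Set.mem_preimage, χ, MonoidHom.comp_apply,
          Subgroup.coe_subtype]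
      rw [this]
      exact hρker.preimage continuous_subtype_val
    · intro hχ
      have hval : ((χ h : (ZMod p)ˣ) : ZMod p) = PadicInt.toZMod (((-1 : ℤ_[p]ˣ) : ℤ_[p])) := rfl
      rw [hχ, Units.val_one, Units.val_neg, Units.val_one, map_neg, map_one] at hval
      exact ZMod.neg_one_ne_one hval.symm
  have hbad := hTF ⊤ (by rw [Subgroup.coe_top]; exact isOpen_univ) h 2 two_ne_zero hdet
  rw [hsq'] at hbad
  obtain ⟨A, _, _, ψ, -, -, hψ⟩ := hbad
  exact hψ (map_one ψ)

/-! ### 4. At the origin data of the genuine constructor: `hTF` both FAILS and HOLDS over inhabited `PiData` -/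

namespace StableCurveTemperedData

namespace OfSpecialFibre

/-- **`hTF` is FALSE at the PiData witness of record** (`Π^temp := G_{ℚ_p} × Aff(ℤ_p)`, `p` odd — abc-iut-L3-t2's
`PiData.exists_temperedCurve_padicAffine`, the datum behind `SpecialFibreTower.PiData.exists_inhabited`): there are
origin data `X, d, S, T` with `PiData X d S T` and `FiniteLevels X d S T` inhabited (admissible kernels `1`, no closed
points, `K = ℚ_p`) at which the printed strongly-torsion-free law on `X.DeltaHat` FAILS (`Δ̂_X ≅ Δ^temp_X ≅ Aff(ℤ_p)`,
`PadicAffine.not_torsionFreeAb`).  So the law package of the §2 one-call has NO witness at that datum.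
([IUTchI] Prop 2.4(i) p.50) [claim: Mochizuki2012, status: disputed] -/
theorem exists_piData_not_torsionFreeAb (p : ℕ) [Fact p.Prime] (hp : p ≠ 2) :
    ∃ (X : TemperedCurve p) (d : X.GroupLevelData) (S : SpecialFibreData (X.toTemperedArithmeticGroup d))
      (T : SpecialFibreTower X.DeltaTemp),
      Nonempty (SpecialFibreTower.PiData X d S T) ∧ SpecialFibreTower.FiniteLevels X d S T ∧ X.K = ⊥ ∧
        IsEmpty X.Pt ∧ (∀ i, T.admKer i = ⊥) ∧
        ¬ ∀ H : Subgroup X.DeltaHat, IsOpen (H : Set X.DeltaHat) → ∀ (h : H) (n : ℕ), n ≠ 0 →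
            SigmaCharDetects Set.univ H h → SigmaCharDetects Set.univ H (h ^ n) := by
  obtain ⟨X, d, S, T, hK, -, hPt, ⟨e, -⟩, hadm, hF, hP⟩ :=
    SpecialFibreTower.PiData.exists_temperedCurve_padicAffine p hp
  haveI : CompactSpace X.DeltaTemp := e.toHomeomorph.compactSpace
  obtain ⟨e₂⟩ := X.nonempty_continuousMulEquiv_deltaHat_of_compactSpace_deltaTemp
  refine ⟨X, d, S, T, hP, hF, hK, hPt, hadm, fun hTF => ?_⟩
  exact PadicAffine.not_torsionFreeAb p hp (torsionFreeAb_of_continuousMulEquiv (e.trans e₂).symm hTF)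

/-- **JOINT NON-VACUITY of `{PiData, FiniteLevels, hTF, hab, hadm}`** at abc-iut-L3-t2's free-profinite witness
(`Π^temp := G_{ℚ_p} × F̂₂`, `K := ℚ_p`, `Δ̂_X ≅ F̂₂`, admissible kernels `1`, every prime `p`): the three laws of the
§2 one-call that are statements about `X.DeltaHat`, the admissible quotients `T.adm i` and the admissible kernels
`T.admKer j` — `hTF` ([Config] Rmk 1.2.2, printed form: by abc-iut-w4-d055's theorem for open subgroups of `F̂₂`,
transported along `F̂₂ ≃ₜ* Δ^temp_X ≃ₜ* Δ̂_X`), `hab` (pro-`Σ` abelianizations along `adm_i`, for EVERY `Σ`: the kernels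
are `1`) and `hadm` (the admissible kernels shrink to `1`: they ARE `1`) — hold SIMULTANEOUSLY over inhabited
`PiData`/`FiniteLevels`.  Consistency evidence for OUR binders; not a curve.
([IUTchI] Prop 2.4(i) p.50) [claim: Mochizuki2012, status: disputed] -/
theorem exists_piData_torsionFreeAb_ab_adm (p : ℕ) [Fact p.Prime] :
    ∃ (X : TemperedCurve p) (d : X.GroupLevelData) (S : SpecialFibreData (X.toTemperedArithmeticGroup d))
      (T : SpecialFibreTower X.DeltaTemp),
      Nonempty (SpecialFibreTower.PiData X d S T) ∧ SpecialFibreTower.FiniteLevels X d S T ∧ X.K = ⊥ ∧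
        IsEmpty X.Pt ∧ (∀ i, T.admKer i = ⊥) ∧
        (∀ H : Subgroup X.DeltaHat, IsOpen (H : Set X.DeltaHat) → ∀ (h : H) (n : ℕ), n ≠ 0 →
            SigmaCharDetects Set.univ H h → SigmaCharDetects Set.univ H (h ^ n)) ∧
        (∀ (Sigma : Set ℕ) (i : ℕ) (A : Type) [CommGroup A] [Finite A] (χ : T.N i →* A),
            IsOpen ((χ.ker : Subgroup (T.N i)) : Set (T.N i)) →
            (∀ q : ℕ, q.Prime → q ∣ Nat.card A → q ∈ Sigma) → (T.adm i).toMonoidHom.ker ≤ χ.ker) ∧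
        (∀ U ∈ 𝓝 (1 : ↥X.DeltaTemp), ∃ j, ((T.admKer j : Subgroup ↥X.DeltaTemp) : Set ↥X.DeltaTemp) ⊆ U) := by
  obtain ⟨X, d, S, T, hK, -, hPt, ⟨e, -⟩, hadm, hF, hP⟩ :=
    SpecialFibreTower.PiData.exists_temperedCurve_freeProfiniteTwo p
  haveI : CompactSpace X.DeltaTemp := e.toHomeomorph.compactSpace
  obtain ⟨e₂⟩ := X.nonempty_continuousMulEquiv_deltaHat_of_compactSpace_deltaTemp
  refine ⟨X, d, S, T, hP, hF, hK, hPt, hadm, ?_, ?_, ?_⟩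
  · -- `hTF`: open subgroups of `F̂₂` have torsion-free abelianization (w4-d055), transported to `Δ̂_X`
    exact torsionFreeAb_of_continuousMulEquiv (e.trans e₂)
      (fun H hH h n hn hdet =>
        ProfiniteCompletion.sigmaCharDetects_univ_pow_of_isFreeGroup (G := FreeGroup (Fin 2)) H hH h n hn hdet)
  · -- `hab`: the admissible kernels are `1`
    intro Sigma i A _ _ χ _ _
    rw [T.ker_adm i, hadm i, Subgroup.bot_subgroupOf]
    exact bot_le
  · -- `hadm`: idem
    intro U hU
    refine ⟨0, ?_⟩
    rw [hadm 0]
    intro x hx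
    rw [SetLike.mem_coe, Subgroup.mem_bot] at hx
    rw [hx]
    exact mem_of_mem_nhds hU

end OfSpecialFibre

end StableCurveTemperedData

end Literature.IUT.HodgeTheaters

end
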